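import Summits.CriticalPhenomena.Ising3DConformalLimit.Theses.ArmHyperscaling
import Summits.CriticalPhenomena.Ising3DConformalLimit.Theorems.HyperoctahedralRPHRP2Rigidity
import Summits.CriticalPhenomena.Ising3DConformalLimit.Theorems.HyperoctahedralRPLimitRotationInvariant
import Summits.CriticalPhenomena.Ising3DConformalLimit.Theorems.MoebiusLimitExists.Negative.FreeTranslations
import Summits.CriticalPhenomena.Ising3DConformalLimit.Theorems.MoebiusLimitExists.Negative.ScaleRedundant
import HarnessLib

/-!
# Disproof of `IsotropyFromOneArm` (stmt-CriticalPhenomena-15593) — findings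

Crux (route `ArmHyperscaling`, rank 9):
`IsotropyFromOneArm := OneArmHyperscaling → C`, with the consequent
`C := ∀ ρ Δ S, (H1) ρ > 0 on (0,1] → (H2) HasPointwiseScalingLimit (criticalCorr 3) ρ S →
  (H3) S = 0 off NonCoincident → (H4) IsNondegenerateTwoPoint S → (H5) IsTranslationInvariant S →
  (H6) IsScaleCovariant Δ S → IsRotationInvariant S`.

cdisprove seat `refuter-cdisprove-stmt-CriticalPhenomena-15593-0`, cycle 1 (2026-08-17).

## Findings (index)

* §0 `crux_proved` — **NO DISPROOF CAN EXIST: the crux is a theorem of the tree**, sorry-free with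
  axioms `{propext, Classical.choice, Quot.sound}` (re-checked here):
  `fun _ => limitRotationInvariant_proof HRP2Rigidity_of` (crux stmt-1980 `LimitRotationInvariant`,
  closed 2026-08-16 via stmt-8367, fed the closed crux stmt-1979 `HRP2Rigidity`).  First recorded by
  `refuter-rattack-stmt-CriticalPhenomena-15593-0` (Proof.lean on the item) and the strategist
  (`Lines/landed_isotropy.lean`); a PROVER lands it as `Theorems/ArmHyperscalingIsotropyFromOneArm.lean`.
* §0 `consequent_holds`, `isotropyFromOneArm_iff` — the antecedent `OneArmHyperscaling` (stmt-15591, an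
  OPEN problem) is **inert**: `C` holds outright, so no hypothesis-dropping variant of the form
  `OneArmHyperscaling → C⁻` can be refuted either (that would require proving the one-arm bound).  The
  load-bearing analysis below is therefore carried out on the consequent `C`.
* §A (H2, the lattice-limit hypothesis) `consequent_false_without_limit` — **load-bearing, unconditionally**:
  the explicit family `witnessA` (`S₂(x,y) = (‖v‖ + |v₀|)/‖v‖²`, `v = x - y`, all other orders `0`) is
  normalised, non-degenerate, translation invariant and scale covariant with `Δ = 1/2`, and is NOT
  `O(3)` invariant (`S₂(e₀,0) = 2 ≠ 1 = S₂(e₁,0)`).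
* §B (H3, the normalisation) `consequentWithoutNorm_iff_no_limit` — **load-bearing modulo existence**:
  dropping (H3) makes the statement EQUIVALENT to the non-existence of any non-degenerate,
  translation-invariant, scale-covariant pointwise scaling limit of `criticalCorr 3` (the values of `S`
  on the coincident locus are unconstrained by (H2),(H4)–(H6) and can be grafted anisotropically at
  order 4: `graft S`).  Corollary `consequent_false_without_norm_of_exists`:
  `ExistsScaleCovariantLimit (stmt-1981) → ¬ ConsequentWithoutNorm` — the same coincident-locus junk
  that refuted item 0637 (`not_inversionUpgrade_of_euclideanLimit`).
* §C (H5),(H6) — **REDUNDANT** (hypothesis mutation, positive direction): `consequent_without_translation`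
  and `consequent_without_scale` hold — translation invariance of a normalised limit is automatic
  (`MoebiusLimitExistsNegative.isTranslationInvariant_normalised_of_limit`, lattice translations +
  adapted meshes) and SOME `Δ' ∈ [1/2,1]` with `IsScaleCovariant Δ' S` is automatic for a normalised
  non-degenerate limit (`MoebiusLimitExistsNegative.exists_scaleCovariant_normalised`); so the
  consequent is equivalent to its lean core `∀ ρ S, (H1) → (H2) → (H3) → (H4) → IsRotationInvariant S`
  (`consequent_iff_core`).  (H1),(H4) — not attackable by this seat (any witness must be a genuine
  scaling limit of `criticalCorr 3`, existence = open item stmt-1981); (H4) is probably redundant too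
  (dichotomy `isNondegenerateTwoPoint_iff_exists_pos`: the degenerate case is `S₂ ≡ 0` on
  `NonCoincident`, where Newman–Lebowitz Gaussian domination should force `S ≡ 0` at all orders `≥ 1`)
  — not pursued.  `Δ` carries no sign hypothesis in the crux; harmless (proved for every `Δ`).
* §D natural strengthenings — `O(3)` WITH reflections is already the conclusion (strongest form);
  dropping the antecedent is the proved `consequent_holds`; dropping (H3) is junk (§B).  Nothing
  further to refute.

WHY IT RESISTS: it is settled positively; the planned Markov-sandwich/one-arm transfer (QT stubs
c1–c4) is bypassed by the landed multiple-reflection sigma bound of crux 8367.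
-/

noncomputable section

open Literature.Probability.LatticeModels Filter Topology

namespace Summit.CriticalPhenomena.Ising3DConformalLimit.Cruxes.IsotropyFromOneArm.Disproof

/-- Shorthand for the Euclidean space `ℝ³`. -/
abbrev E3 : Type := EuclideanSpace ℝ (Fin 3)

/-! ## §0  The crux is a theorem; the one-arm antecedent is inert -/

/-- The consequent `C` of the crux (verbatim the consequent of `HyperoctahedralRP.LimitRotationInvariant`). -/
def Consequent : Prop :=
  ∀ (ρ : ℝ → ℝ) (Δ : ℝ) (S : CorrFamily 3), (∀ δ ∈ Set.Ioc (0:ℝ) 1, 0 < ρ δ) →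
    HasPointwiseScalingLimit (criticalCorr 3) ρ S → (∀ n z, z ∉ NonCoincident 3 n → S n z = 0) →
    IsNondegenerateTwoPoint S → IsTranslationInvariant S → IsScaleCovariant Δ S → IsRotationInvariant S

/-- The crux is literally `OneArmHyperscaling → Consequent`. -/
theorem isotropyFromOneArm_iff :
    Theses.ArmHyperscaling.IsotropyFromOneArm ↔ (Theses.ArmHyperscaling.OneArmHyperscaling → Consequent) :=
  Iff.rfl

/-- The consequent holds outright (landed cruxes 1980 ∘ 1979): the one-arm antecedent is NOT load-bearing. -/
theorem consequent_holds : Consequent :=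
  LimitRotationInvariant.QuarterTurnLiouville.limitRotationInvariant_proof HRP2Rigidity.XRayMellin.HRP2Rigidity_of

/-- **No disproof exists**: the crux is proved (candidate proof already attached to the item by the
rattack/cstrat seats; recorded here only as the reason the disproof attempt stops). -/
theorem crux_proved : Theses.ArmHyperscaling.IsotropyFromOneArm := fun _ => consequent_holds

/-- Hence its negation is refutable. -/
theorem not_not_crux : ¬ ¬ Theses.ArmHyperscaling.IsotropyFromOneArm := fun h => h crux_proved

/-! ## §A  (H2) is load-bearing: without the lattice-limit hypothesis the consequent is false -/

/-- `C` with the limit hypothesis (H2) dropped. -/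
def ConsequentWithoutLimit : Prop :=
  ∀ (ρ : ℝ → ℝ) (Δ : ℝ) (S : CorrFamily 3), (∀ δ ∈ Set.Ioc (0:ℝ) 1, 0 < ρ δ) →
    (∀ n z, z ∉ NonCoincident 3 n → S n z = 0) →
    IsNondegenerateTwoPoint S → IsTranslationInvariant S → IsScaleCovariant Δ S → IsRotationInvariant S

/-- The anisotropic kernel `(‖v‖ + |v₀|) / ‖v‖²`, homogeneous of degree `-1`, vanishing at `0`. -/
def anisoKernel (v : E3) : ℝ := (‖v‖ + |v 0|) * (‖v‖ ^ 2)⁻¹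

theorem anisoKernel_zero : anisoKernel 0 = 0 := by simp [anisoKernel]

theorem anisoKernel_pos {v : E3} (hv : v ≠ 0) : 0 < anisoKernel v := by
  have h : 0 < ‖v‖ := norm_pos_iff.mpr hv
  exact mul_pos (add_pos_of_pos_of_nonneg h (abs_nonneg _)) (inv_pos.mpr (pow_pos h 2))

theorem anisoKernel_smul {c : ℝ} (hc : 0 < c) (v : E3) : anisoKernel (c • v) = c⁻¹ * anisoKernel v := by
  by_cases hv : v = 0
  · subst hv; simp [anisoKernel_zero]
  · have h : 0 < ‖v‖ := norm_pos_iff.mpr hv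
    simp only [anisoKernel, norm_smul, PiLp.smul_apply, smul_eq_mul, abs_mul, Real.norm_eq_abs,
      abs_of_pos hc]
    field_simp

/-- Witness A: `S₂(x₀,x₁) = anisoKernel (x₀ - x₁)`, all other orders `0`. -/
def witnessA : CorrFamily 3 := fun n =>
  match n with
  | 2 => fun x => anisoKernel (x 0 - x 1)
  | _ => fun _ => 0

theorem witnessA_two (x : Fin 2 → E3) : witnessA 2 x = anisoKernel (x 0 - x 1) := rfl

theorem witnessA_normalised : ∀ n z, z ∉ NonCoincident 3 n → witnessA n z = 0 := by
  intro n z hz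
  match n, z with
  | 2, z =>
    have h01 : z 0 = z 1 := by
      by_contra h
      apply hz
      intro i j hij
      fin_cases i <;> fin_cases j
      · rfl
      · exact absurd hij h
      · exact absurd hij.symm h
      · rfl
    rw [witnessA_two, h01, sub_self, anisoKernel_zero]
  | 0, _ => rfl
  | 1, _ => rfl
  | 3, _ => rfl
  | (n + 4), _ => rfl

theorem witnessA_isNondegenerateTwoPoint : IsNondegenerateTwoPoint witnessA := by
  intro x hx
  have hne : x 0 ≠ x 1 := fun h => absurd ((mem_nonCoincident x).1 hx h) (by decide)
  rw [witnessA_two]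
  exact anisoKernel_pos (sub_ne_zero.mpr hne)

theorem witnessA_isTranslationInvariant : IsTranslationInvariant witnessA := by
  intro n v x
  match n, x with
  | 2, x => simp [witnessA_two]
  | 0, _ => rfl
  | 1, _ => rfl
  | 3, _ => rfl
  | (n + 4), _ => rfl

theorem witnessA_isScaleCovariant : IsScaleCovariant (1 / 2) witnessA := by
  intro n c hc x
  match n, x with
  | 2, x =>
    have h1 : (-((2 : ℕ) : ℝ) * (1 / 2)) = -1 := by norm_num
    rw [witnessA_two, witnessA_two, h1, Real.rpow_neg_one, ← smul_sub, anisoKernel_smul hc]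
  | 0, _ => simp [witnessA]
  | 1, _ => simp [witnessA]
  | 3, _ => simp [witnessA]
  | (n + 4), _ => simp [witnessA]

/-- The unit vectors `e₀`, `e₁`. -/
def e0 : E3 := EuclideanSpace.single 0 1
def e1 : E3 := EuclideanSpace.single 1 1

theorem norm_e0 : ‖e0‖ = 1 := by simp [e0]
theorem norm_e1 : ‖e1‖ = 1 := by simp [e1]
theorem anisoKernel_e0 : anisoKernel e0 = 2 := by
  rw [anisoKernel, norm_e0]; simp [e0]; norm_num
theorem anisoKernel_e1 : anisoKernel e1 = 1 := by
  rw [anisoKernel, norm_e1]; simp [e1]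

/-- A linear isometry of `ℝ³` taking `e₀` to `e₁` (Householder reflection). -/
def swap01 : E3 ≃ₗᵢ[ℝ] E3 := (ℝ ∙ (e0 - e1))ᗮ.reflection

theorem swap01_e0 : swap01 e0 = e1 := Submodule.reflection_sub (by rw [norm_e0, norm_e1])

theorem witnessA_not_isRotationInvariant : ¬ IsRotationInvariant witnessA := by
  intro hR
  have h := hR 2 swap01 ![e0, 0]
  have hl : (fun i => swap01 ((![e0, 0] : Fin 2 → E3) i)) = ![e1, 0] := by
    funext i; fin_cases i <;> simp [swap01_e0]
  rw [hl, witnessA_two, witnessA_two] at h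
  simp only [Matrix.cons_val_zero, Matrix.cons_val_one, sub_zero, anisoKernel_e0,
    anisoKernel_e1] at h
  norm_num at h

/-- **(H2) is load-bearing.** Any proof of the consequent must use that `S` is a scaling limit of the
critical `ℤ³` Ising correlators: the purely axiomatic remainder is false. -/
theorem consequent_false_without_limit : ¬ ConsequentWithoutLimit := fun h =>
  witnessA_not_isRotationInvariant
    (h (fun _ => 1) (1 / 2) witnessA (fun _ _ => one_pos) witnessA_normalised
      witnessA_isNondegenerateTwoPoint witnessA_isTranslationInvariant witnessA_isScaleCovariant)

/-! ## §B  (H3) is load-bearing modulo existence: without the normalisation the statement is junk -/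

/-- `C` with the normalisation (H3) dropped. -/
def ConsequentWithoutNorm : Prop :=
  ∀ (ρ : ℝ → ℝ) (Δ : ℝ) (S : CorrFamily 3), (∀ δ ∈ Set.Ioc (0:ℝ) 1, 0 < ρ δ) →
    HasPointwiseScalingLimit (criticalCorr 3) ρ S →
    IsNondegenerateTwoPoint S → IsTranslationInvariant S → IsScaleCovariant Δ S → IsRotationInvariant S

/-- Existence of an admissible (not necessarily normalised) limit: (H1),(H2),(H4),(H5),(H6). -/
def ExistsAdmissibleLimit : Prop :=
  ∃ (ρ : ℝ → ℝ) (Δ : ℝ) (S : CorrFamily 3), (∀ δ ∈ Set.Ioc (0:ℝ) 1, 0 < ρ δ) ∧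
    HasPointwiseScalingLimit (criticalCorr 3) ρ S ∧
    IsNondegenerateTwoPoint S ∧ IsTranslationInvariant S ∧ IsScaleCovariant Δ S

/-- The degree-`0` anisotropic factor `|v₀| / ‖v‖` (`= 0` at `v = 0`). -/
def dirFactor (v : E3) : ℝ := |v 0| / ‖v‖

theorem dirFactor_smul {c : ℝ} (hc : 0 < c) (v : E3) : dirFactor (c • v) = dirFactor v := by
  simp only [dirFactor, norm_smul, PiLp.smul_apply, smul_eq_mul, abs_mul, Real.norm_eq_abs, abs_of_pos hc]
  exact mul_div_mul_left _ _ hc.ne'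

theorem dirFactor_e0 : dirFactor (-e0) = 1 := by
  rw [dirFactor, norm_neg, norm_e0]; simp [e0]
theorem dirFactor_e1 : dirFactor (-e1) = 0 := by
  rw [dirFactor, norm_neg, norm_e1]; simp [e1]

/-- The anisotropic graft term, supported at order `4`: `S₂(z₀,z₂)·S₂(z₁,z₃)·dirFactor(z₀ - z₂)`
(degree `-4Δ` whenever `S` is `Δ`-scale covariant). -/
def graftTerm (S : CorrFamily 3) : CorrFamily 3 := fun n =>
  match n with
  | 4 => fun z => S 2 ![z 0, z 2] * S 2 ![z 1, z 3] * dirFactor (z 0 - z 2)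
  | _ => fun _ => 0

theorem graftTerm_four (S : CorrFamily 3) (z : Fin 4 → E3) :
    graftTerm S 4 z = S 2 ![z 0, z 2] * S 2 ![z 1, z 3] * dirFactor (z 0 - z 2) := rfl

/-- `graft S`: `S` on non-coincident configurations, the anisotropic graft term on the coincident locus. -/
def graft (S : CorrFamily 3) : CorrFamily 3 := fun n z =>
  open Classical in if z ∈ NonCoincident 3 n then S n z else graftTerm S n z

theorem graft_of_mem {S : CorrFamily 3} {n : ℕ} {z : Fin n → E3} (hz : z ∈ NonCoincident 3 n) :
    graft S n z = S n z := by simp [graft, hz]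

theorem graft_of_not_mem {S : CorrFamily 3} {n : ℕ} {z : Fin n → E3} (hz : z ∉ NonCoincident 3 n) :
    graft S n z = graftTerm S n z := by simp [graft, hz]

theorem mem_nonCoincident_add_iff {n : ℕ} (z : Fin n → E3) (v : E3) :
    (fun i => z i + v) ∈ NonCoincident 3 n ↔ z ∈ NonCoincident 3 n :=
  (add_left_injective v).of_comp_iff z

theorem mem_nonCoincident_smul_iff {n : ℕ} (z : Fin n → E3) {c : ℝ} (hc : c ≠ 0) :
    (fun i => c • z i) ∈ NonCoincident 3 n ↔ z ∈ NonCoincident 3 n :=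
  (smul_right_injective E3 hc).of_comp_iff z

theorem graft_hasLimit {S : CorrFamily 3} {ρ : ℝ → ℝ}
    (h : HasPointwiseScalingLimit (criticalCorr 3) ρ S) :
    HasPointwiseScalingLimit (criticalCorr 3) ρ (graft S) := fun n =>
  (h n).congr_right fun _ hz => (graft_of_mem hz).symm

theorem graft_isNondegenerateTwoPoint {S : CorrFamily 3} (h : IsNondegenerateTwoPoint S) :
    IsNondegenerateTwoPoint (graft S) := fun x hx => by
  rw [graft_of_mem hx]; exact h x hx

theorem graftTerm_translate {S : CorrFamily 3} (hT : IsTranslationInvariant S) (n : ℕ) (v : E3)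
    (z : Fin n → E3) : graftTerm S n (fun i => z i + v) = graftTerm S n z := by
  match n, z with
  | 4, z =>
    rw [graftTerm_four, graftTerm_four]
    have h02 := hT 2 v ![z 0, z 2]
    have h13 := hT 2 v ![z 1, z 3]
    have e02 : (fun i => (![z 0, z 2] : Fin 2 → E3) i + v) = ![z 0 + v, z 2 + v] := by
      funext i; fin_cases i <;> rfl
    have e13 : (fun i => (![z 1, z 3] : Fin 2 → E3) i + v) = ![z 1 + v, z 3 + v] := by
      funext i; fin_cases i <;> rfl
    rw [e02] at h02
    rw [e13] at h13
    rw [h02, h13, add_sub_add_right_eq_sub]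
  | 0, _ => rfl
  | 1, _ => rfl
  | 2, _ => rfl
  | 3, _ => rfl
  | (n + 5), _ => rfl

theorem graft_isTranslationInvariant {S : CorrFamily 3} (hT : IsTranslationInvariant S) :
    IsTranslationInvariant (graft S) := by
  intro n v z
  by_cases hz : z ∈ NonCoincident 3 n
  · rw [graft_of_mem hz, graft_of_mem ((mem_nonCoincident_add_iff z v).2 hz), hT]
  · rw [graft_of_not_mem hz, graft_of_not_mem (fun h => hz ((mem_nonCoincident_add_iff z v).1 h)),
      graftTerm_translate hT]

theorem graftTerm_smul {S : CorrFamily 3} {Δ : ℝ} (hS : IsScaleCovariant Δ S) (n : ℕ) {c : ℝ}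
    (hc : 0 < c) (z : Fin n → E3) :
    graftTerm S n (fun i => c • z i) = c ^ (-(n : ℝ) * Δ) * graftTerm S n z := by
  match n, z with
  | 4, z =>
    rw [graftTerm_four, graftTerm_four]
    have h02 := hS 2 c hc ![z 0, z 2]
    have h13 := hS 2 c hc ![z 1, z 3]
    have e02 : (fun i => c • (![z 0, z 2] : Fin 2 → E3) i) = ![c • z 0, c • z 2] := by
      funext i; fin_cases i <;> rfl
    have e13 : (fun i => c • (![z 1, z 3] : Fin 2 → E3) i) = ![c • z 1, c • z 3] := by
      funext i; fin_cases i <;> rfl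
    rw [e02] at h02
    rw [e13] at h13
    rw [h02, h13, ← smul_sub, dirFactor_smul hc]
    have h4 : c ^ (-((4 : ℕ) : ℝ) * Δ) = c ^ (-((2 : ℕ) : ℝ) * Δ) * c ^ (-((2 : ℕ) : ℝ) * Δ) := by
      rw [← Real.rpow_add hc]; congr 1; push_cast; ring
    rw [h4]; ring
  | 0, _ => simp [graftTerm]
  | 1, _ => simp [graftTerm]
  | 2, _ => simp [graftTerm]
  | 3, _ => simp [graftTerm]
  | (n + 5), _ => simp [graftTerm]

theorem graft_isScaleCovariant {S : CorrFamily 3} {Δ : ℝ} (hS : IsScaleCovariant Δ S) :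
    IsScaleCovariant Δ (graft S) := by
  intro n c hc z
  by_cases hz : z ∈ NonCoincident 3 n
  · rw [graft_of_mem hz, graft_of_mem ((mem_nonCoincident_smul_iff z hc.ne').2 hz), hS n c hc z]
  · rw [graft_of_not_mem hz,
      graft_of_not_mem (fun h => hz ((mem_nonCoincident_smul_iff z hc.ne').1 h)), graftTerm_smul hS n hc]

/-- The coincident test configuration `(0, 0, e₀, e₀)`. -/
def cfg : Fin 4 → E3 := ![0, 0, e0, e0]

theorem cfg_not_mem : cfg ∉ NonCoincident 3 4 := by
  intro h
  have := (mem_nonCoincident cfg).1 h (show cfg 0 = cfg 1 by simp [cfg])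
  exact absurd this (by decide)

theorem swap_cfg_eq : (fun i => swap01 (cfg i)) = ![0, 0, e1, e1] := by
  funext i; fin_cases i <;> simp [cfg, swap01_e0]

theorem swap_cfg_not_mem : (fun i => swap01 (cfg i)) ∉ NonCoincident 3 4 := by
  rw [swap_cfg_eq]
  intro h
  have := (mem_nonCoincident _).1 h (show (![0, 0, e1, e1] : Fin 4 → E3) 0 = ![0, 0, e1, e1] 1 by simp)
  exact absurd this (by decide)

theorem e0_ne_zero : e0 ≠ 0 := fun h => by simpa [h] using norm_e0

theorem pair_mem : (![0, e0] : Fin 2 → E3) ∈ NonCoincident 3 2 := by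
  rw [mem_nonCoincident]
  intro i j hij
  fin_cases i <;> fin_cases j
  · rfl
  · exact absurd hij.symm (by simpa using e0_ne_zero)
  · exact absurd hij (by simpa using e0_ne_zero)
  · rfl

/-- The graft of a non-degenerate family is not `O(3)` invariant. -/
theorem graft_not_isRotationInvariant {S : CorrFamily 3} (hnd : IsNondegenerateTwoPoint S) :
    ¬ IsRotationInvariant (graft S) := by
  intro hR
  have h := hR 4 swap01 cfg
  rw [graft_of_not_mem swap_cfg_not_mem, graft_of_not_mem cfg_not_mem, swap_cfg_eq,
    graftTerm_four, graftTerm_four] at h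
  simp only [cfg, Matrix.cons_val_zero, Matrix.cons_val_one, Matrix.cons_val_two, Matrix.cons_val_three,
    Matrix.head_cons, Matrix.tail_cons, zero_sub, dirFactor_e0, dirFactor_e1, mul_zero, mul_one] at h
  have hpos : 0 < S 2 ![0, e0] := hnd _ pair_mem
  nlinarith [mul_pos hpos hpos]

/-- **(H3) is load-bearing modulo existence.**  Without the normalisation clause the statement is
EQUIVALENT to the non-existence of any admissible scaling limit: given one, its anisotropic graft on the
coincident locus satisfies every remaining hypothesis and is not rotation invariant. -/
theorem consequentWithoutNorm_iff_no_limit : ConsequentWithoutNorm ↔ ¬ ExistsAdmissibleLimit := by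
  constructor
  · rintro h ⟨ρ, Δ, S, hρ, hlim, hnd, htr, hsc⟩
    exact graft_not_isRotationInvariant hnd
      (h ρ Δ (graft S) hρ (graft_hasLimit hlim) (graft_isNondegenerateTwoPoint hnd)
        (graft_isTranslationInvariant htr) (graft_isScaleCovariant hsc))
  · intro hne ρ Δ S hρ hlim hnd htr hsc
    exact absurd ⟨ρ, Δ, S, hρ, hlim, hnd, htr, hsc⟩ hne

/-- Corollary: under the route's own existence crux `ExistsScaleCovariantLimit` (stmt-1981) the
un-normalised variant is FALSE. -/
theorem consequent_false_without_norm_of_exists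
    (hE : Theses.ArmHyperscaling.ExistsScaleCovariantLimit) : ¬ ConsequentWithoutNorm := by
  obtain ⟨ρ, Δ, S, hρ, -, hlim, -, hnd, htr, hsc⟩ := hE
  exact fun h => consequentWithoutNorm_iff_no_limit.1 h ⟨ρ, Δ, S, hρ, hlim, hnd, htr, hsc⟩

/-! ## §C  (H5) and (H6) are redundant: the consequent equals its lean core -/

/-- A normalised family is its own normalisation. -/
theorem normalise_eq_self {S : CorrFamily 3} (hnorm : ∀ n z, z ∉ NonCoincident 3 n → S n z = 0) :
    (fun n x => open Classical in if x ∈ NonCoincident 3 n then S n x else 0) = S := by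
  funext n x
  split_ifs with h
  · rfl
  · exact (hnorm n x h).symm

/-- `C` with (H5) dropped HOLDS: translation invariance of a normalised limit is automatic. -/
theorem consequent_without_translation :
    ∀ (ρ : ℝ → ℝ) (Δ : ℝ) (S : CorrFamily 3), (∀ δ ∈ Set.Ioc (0:ℝ) 1, 0 < ρ δ) →
      HasPointwiseScalingLimit (criticalCorr 3) ρ S → (∀ n z, z ∉ NonCoincident 3 n → S n z = 0) →
      IsNondegenerateTwoPoint S → IsScaleCovariant Δ S → IsRotationInvariant S := by
  intro ρ Δ S hρ hlim hnorm hnd hsc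
  have htr := MoebiusLimitExistsNegative.isTranslationInvariant_normalised_of_limit hlim
  rw [normalise_eq_self hnorm] at htr
  exact consequent_holds ρ Δ S hρ hlim hnorm hnd htr hsc

/-- `C` with (H5) AND (H6) dropped HOLDS (the lean core): some `Δ' ∈ [1/2,1]` is automatic. -/
theorem consequent_core :
    ∀ (ρ : ℝ → ℝ) (S : CorrFamily 3), (∀ δ ∈ Set.Ioc (0:ℝ) 1, 0 < ρ δ) →
      HasPointwiseScalingLimit (criticalCorr 3) ρ S → (∀ n z, z ∉ NonCoincident 3 n → S n z = 0) →
      IsNondegenerateTwoPoint S → IsRotationInvariant S := by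
  intro ρ S hρ hlim hnorm hnd
  obtain ⟨Δ', -, hsc⟩ := MoebiusLimitExistsNegative.exists_scaleCovariant_normalised hρ hlim hnd
  rw [normalise_eq_self hnorm] at hsc
  exact consequent_without_translation ρ Δ' S hρ hlim hnorm hnd hsc

/-- Alias: `C` with (H6) dropped. -/
theorem consequent_without_scale :
    ∀ (ρ : ℝ → ℝ) (S : CorrFamily 3), (∀ δ ∈ Set.Ioc (0:ℝ) 1, 0 < ρ δ) →
      HasPointwiseScalingLimit (criticalCorr 3) ρ S → (∀ n z, z ∉ NonCoincident 3 n → S n z = 0) →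
      IsNondegenerateTwoPoint S → IsTranslationInvariant S → IsRotationInvariant S :=
  fun ρ S hρ hlim hnorm hnd _ => consequent_core ρ S hρ hlim hnorm hnd

/-- The consequent is equivalent to its lean core (both are theorems; recorded as the mutation result
"(H5), (H6) unnecessary"). -/
theorem consequent_iff_core :
    Consequent ↔ ∀ (ρ : ℝ → ℝ) (S : CorrFamily 3), (∀ δ ∈ Set.Ioc (0:ℝ) 1, 0 < ρ δ) →
      HasPointwiseScalingLimit (criticalCorr 3) ρ S → (∀ n z, z ∉ NonCoincident 3 n → S n z = 0) →
      IsNondegenerateTwoPoint S → IsRotationInvariant S :=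
  ⟨fun _ => consequent_core, fun _ => consequent_holds⟩

end Summit.CriticalPhenomena.Ising3DConformalLimit.Cruxes.IsotropyFromOneArm.Disproof

end
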